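import Mathlib
import Summits.Ventures.PercRepro.TriangleCapBelowCornerBig
import Summits.Ventures.PercRepro.TriangleCapBelowWitnessAll

/-!
# PercRepro — THE B2 REGIME OF THE STABILITY TABLE FOR EVERY ROW: every cell `r ≤ a − 3` of every row `a ≥ 4`,
`2a + r ≤ k` — the bound `a ≤ 18` of part 200zi is gone (p3, gen 49; part 204b)

The induction of part 200zi (`below_second_order_all`, strong induction on `k`: the cap `below_cap_gen`, the
convexity of the row `a + 1`, the cross-row deletion, the within-row deletion onto `(k − 1, a, r′)`, and at the corner
`k = 2a + r` the window) with the corner replaced by `below_corner_every` (part 204a: the near-cap vertex for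
`a ≥ 3r + 1`, the window otherwise). Corollaries: the non-`a`-bipartite second-best value on every cell `r ≤ a − 3`
of every row `a ≥ 4` is EXACTLY `closed − 2 (k − 2a − 1)(a − r)` (the family `B2`, `below_witness_all`), and the
second-best value of the cherry table is `closed − 2 (r − 2)` for `3 ≤ r ≤ a − 3` — the first open corner
`(41, 19, 3)` of part 200zi(d) included. Axioms: standard.
-/

namespace PercRepro

namespace TriangleCap

namespace C047

open Finset

universe u

/-- **THE B2 REGIME BY INDUCTION ON `k`, EVERY VERTEX TYPE, EVERY ROW:** `K₄⁻`-free, `4 ≤ a`, `r + 3 ≤ a`,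
`2a + r ≤ k`, `m + r = a (k − a)` ⇒ `a`-bipartite or `Σ_v d(v)² + r (k − 1 − r) + 2 (k − 2a − 1)(a − r) ≤ m k`. -/
theorem below_second_order_every_aux (n : ℕ) :
    ∀ (W : Type u) [Fintype W] [DecidableEq W] (D : SimpleGraph W) [DecidableRel D.Adj], Fintype.card W = n →
      K4mFree D → ∀ a r : ℕ, 4 ≤ a → r + 3 ≤ a →
      2 * a + r ≤ Fintype.card W → D.edgeFinset.card + r = a * (Fintype.card W - a) →
      (∃ A : Finset W, A.card = a ∧ BipSub D A) ∨
        ∑ v, deg D v * deg D v + r * (Fintype.card W - 1 - r) + 2 * (Fintype.card W - 2 * a - 1) * (a - r) ≤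
          D.edgeFinset.card * Fintype.card W := by
  refine Nat.strong_induction_on n ?_
  intro n ih W _ _ D _ hn hK a r ha4 har hk hm
  -- `k ≤ 2a + 1`: the closed form
  rcases Nat.lt_or_ge (Fintype.card W) (2 * a + 2) with hk1 | hk2
  · right
    have h := closed_form_stability D hK a r (by omega) hk
      (below_cap_arith a (Fintype.card W) D.edgeFinset.card r (by omega) hm)
    have e : Fintype.card W - 2 * a - 1 = 0 := by omega
    rw [e, mul_zero, zero_mul, add_zero]
    exact h
  -- (A) a vertex at the cap `k − a` makes `D` `a`-bipartite
  by_cases hx : ∃ x, deg D x + a = Fintype.card W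
  · obtain ⟨x, hx⟩ := hx
    exact Or.inl (below_cap_gen D hK a r ha4 har hk hm (by omega) (fun _ => by omega) x hx)
  push Not at hx
  have hcap : ∀ v, deg D v + a ≤ Fintype.card W := fun v =>
    deg_add_le_card_of_dense D hK a (by omega) (by omega)
      (cap_arith a (Fintype.card W) D.edgeFinset.card r (by omega) hk
        (below_cap_arith a (Fintype.card W) D.edgeFinset.card r (by omega) hm)) v
  have hcap' : ∀ v, deg D v + a + 1 ≤ Fintype.card W := fun v => by
    have h1 := hcap v
    have h2 := hx v
    omega
  -- (B) every degree `≥ a + 1`: the convexity of the row `a + 1`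
  by_cases hdeg : ∀ v, a + 1 ≤ deg D v
  · right
    have h := below_convex_gen D a r (by omega) (by omega) hm hcap' hdeg
    have h2 : 2 * (Fintype.card W - 2 * a - 1) * (a - r) ≤
        Fintype.card W * (Fintype.card W - 2 * a - 1) := by
      rw [mul_right_comm]
      exact Nat.mul_le_mul_right _ (by omega)
    omega
  push Not at hdeg
  -- (B') every degree `≥ a`, some vertex of degree exactly `a`
  by_cases hdega : ∀ v, a ≤ deg D v
  · obtain ⟨z, hz⟩ := hdeg
    have hza : deg D z = a := by have := hdega z; omega
    rcases Nat.lt_or_ge (Fintype.card W) (2 * a + r + 1) with hcorner | hnot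
    · -- THE CORNER `k = 2a + r`: the near-cap vertex or the window
      right
      exact below_corner_every D hK a r har hk2 (by omega) hm hcap' hdega
    · -- `k ≥ 2a + r + 1`: the within-row deletion onto `(k − 1, a, r)`
      have hedges' := card_edges_del D z
      have hm' : (del D z).edgeFinset.card + r = a * (Fintype.card {v : W // v ≠ z} - a) := by
        have e : Fintype.card {v : W // v ≠ z} = Fintype.card W - 1 := by have := card_del z; omega
        rw [e]
        exact below_cell_edges a r r (deg D z) (Fintype.card W) D.edgeFinset.card (del D z).edgeFinset.card
          hk2 (by omega) hedges' hm
      have hIH := ih (Fintype.card {v : W // v ≠ z}) (by have := card_del z; omega) {v : W // v ≠ z} (del D z) rfl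
        (k4mFree_del D hK z) a r ha4 har (by have := card_del z; omega) hm'
      exact below_within_case D hK a r har hk2 hm hcap' z (by omega) r (by omega) hIH
  push Not at hdega
  obtain ⟨z, hz⟩ := hdega
  -- (C) `r + d ≤ a − 1`: the cross-row deletion
  rcases Nat.lt_or_ge (r + deg D z) a with hz1 | hz2
  · exact Or.inr (below_cross_gen D hK a r (by omega) hk2 hm hcap' z (by omega))
  -- (D) `r + d ≥ a`, `d ≤ a − 1`: the deletion onto the cell `(k − 1, a, r')`, `r' = r + d − a ≤ r − 1`
  obtain ⟨r', hr'⟩ : ∃ r', r + deg D z = a + r' := ⟨r + deg D z - a, by omega⟩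
  have hcard' := card_del z
  have hedges' := card_edges_del D z
  have hm' : (del D z).edgeFinset.card + r' = a * (Fintype.card {v : W // v ≠ z} - a) := by
    have e : Fintype.card {v : W // v ≠ z} = Fintype.card W - 1 := by omega
    rw [e]
    exact below_cell_edges a r r' (deg D z) (Fintype.card W) D.edgeFinset.card (del D z).edgeFinset.card
      hk2 hr' hedges' hm
  have hIH := ih (Fintype.card {v : W // v ≠ z}) (by omega) {v : W // v ≠ z} (del D z) rfl
    (k4mFree_del D hK z) a r' ha4 (by omega) (by omega) hm'
  exact below_within_case D hK a r har hk2 hm hcap' z (by omega) r' hr' hIH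

variable {V : Type*} [Fintype V] [DecidableEq V]

/-- **THE B2 REGIME FOR EVERY ROW:** `K₄⁻`-free, `4 ≤ a`, `r + 3 ≤ a`, `2a + r ≤ k`, `m + r = a (k − a)` ⇒
`a`-bipartite or `Σ_v d(v)² + r (k − 1 − r) + 2 (k − 2a − 1)(a − r) ≤ m k` — no bound on `a`. -/
theorem below_second_order_every (D : SimpleGraph V) [DecidableRel D.Adj] (hK : K4mFree D) (a r : ℕ)
    (ha4 : 4 ≤ a) (har : r + 3 ≤ a) (hk : 2 * a + r ≤ Fintype.card V)
    (hm : D.edgeFinset.card + r = a * (Fintype.card V - a)) :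
    (∃ A : Finset V, A.card = a ∧ BipSub D A) ∨
      ∑ v, deg D v * deg D v + r * (Fintype.card V - 1 - r) + 2 * (Fintype.card V - 2 * a - 1) * (a - r) ≤
        D.edgeFinset.card * Fintype.card V :=
  below_second_order_every_aux (Fintype.card V) V D rfl hK a r ha4 har hk hm

/-- **THE NON-BIPARTITE SECOND-BEST VALUE ON EVERY CELL `r ≤ a − 3` OF EVERY ROW `a ≥ 4`**, `2a + 2 ≤ k`,
`2a + r ≤ k`: EXACTLY `m k − r (k − 1 − r) − 2 (k − 2a − 1)(a − r)`, attained by the family `B2`. -/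
theorem below_nonbip_second_best_every (k a r : ℕ) (ha4 : 4 ≤ a) (har : r + 3 ≤ a)
    (hk : 2 * a + 2 ≤ k) (hkr : 2 * a + r ≤ k) :
    (∀ (D : SimpleGraph (Fin k)) [DecidableRel D.Adj], K4mFree D → D.edgeFinset.card + r = a * (k - a) →
        (¬ ∃ A : Finset (Fin k), A.card = a ∧ BipSub D A) →
        ∑ v, deg D v * deg D v + r * (k - 1 - r) + 2 * (k - 2 * a - 1) * (a - r) ≤ D.edgeFinset.card * k) ∧
      ∃ (D : SimpleGraph (Fin k)) (_ : DecidableRel D.Adj), K4mFree D ∧ D.edgeFinset.card + r = a * (k - a) ∧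
        (¬ ∃ A : Finset (Fin k), A.card = a ∧ BipSub D A) ∧
        ∑ v, deg D v * deg D v + r * (k - 1 - r) + 2 * (k - 2 * a - 1) * (a - r) = D.edgeFinset.card * k := by
  have hcard : Fintype.card (Fin k) = k := Fintype.card_fin k
  refine ⟨?_, ?_⟩
  · intro D _ hK hm hnb
    rcases below_second_order_every D hK a r ha4 har (by rw [hcard]; exact hkr) (by rw [hcard]; exact hm)
      with h | h
    · exact absurd h hnb
    · rw [hcard] at h
      exact h
  · obtain ⟨hK, hE, hnb, hS⟩ := below_witness_all k a r har hk
    exact ⟨_, inferInstance, hK, hE, hnb, hS⟩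

/-- **THE SECOND-BEST VALUE OF THE CHERRY TABLE ON EVERY CELL `3 ≤ r ≤ a − 3` OF EVERY ROW**, `2a + r ≤ k`:
`closed − 2 (r − 2)` (the brooms) — no bound on `a`. -/
theorem second_best_below_every (k a r : ℕ) (hr3 : 3 ≤ r) (har : r + 3 ≤ a) (hkr : 2 * a + r ≤ k) :
    (∀ (D : SimpleGraph (Fin k)) [DecidableRel D.Adj], K4mFree D → D.edgeFinset.card + r = a * (k - a) →
        ∑ v, deg D v * deg D v + r * (k - 1 - r) ≠ D.edgeFinset.card * k →
        ∑ v, deg D v * deg D v + r * (k - 1 - r) + 2 * (r - 2) ≤ D.edgeFinset.card * k) ∧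
      ∃ (D : SimpleGraph (Fin k)) (_ : DecidableRel D.Adj), K4mFree D ∧ D.edgeFinset.card + r = a * (k - a) ∧
        ∑ v, deg D v * deg D v + r * (k - 1 - r) + 2 * (r - 2) = D.edgeFinset.card * k := by
  have hcard : Fintype.card (Fin k) = k := Fintype.card_fin k
  refine ⟨?_, ?_⟩
  · intro D _ hK hm hne
    rcases below_second_order_every D hK a r (by omega) har (by rw [hcard]; exact hkr) (by rw [hcard]; exact hm)
      with ⟨A, hAcard, hB⟩ | h
    · by_cases hstar : ∃ v, MissingStar D A v
      · obtain ⟨v, hv⟩ := hstar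
        have h := closed_form_eq_of_missingStar D A hB hv a r hAcard (by rw [hcard]; exact hm)
          (by rw [hcard]; omega)
        rw [hcard] at h
        exact absurd h hne
      · have h := closed_form_stability_bipSub D A hB a r hAcard (by rw [hcard]; exact hm) (by rw [hcard]; omega)
          (by omega) hstar
        rw [hcard] at h
        exact h
    · rw [hcard] at h
      have hge : 2 * (r - 2) ≤ 2 * (k - 2 * a - 1) * (a - r) := by
        have h1 : r - 1 ≤ k - 2 * a - 1 := by omega
        have h3 : 1 ≤ a - r := by omega
        calc 2 * (r - 2) = 2 * (r - 2) * 1 := by ring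
          _ ≤ 2 * (r - 1) * (a - r) := Nat.mul_le_mul (by omega) h3
          _ ≤ 2 * (k - 2 * a - 1) * (a - r) := Nat.mul_le_mul_right _ (by omega)
      omega
  · obtain ⟨D, inst, A, hK, hAcard, hB, hns, hE, hS⟩ := broom_value k a r (by omega) (by omega) (by omega)
    have hr' : r ≤ a * (k - a) := by
      have h2 : 1 * (k - a) ≤ a * (k - a) := Nat.mul_le_mul_right _ (by omega)
      omega
    have hE' : D.edgeFinset.card + r = a * (k - a) := by rw [hE]; omega
    refine ⟨D, inst, hK, hE', ?_⟩
    rw [hE]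
    exact hS

end C047

end TriangleCap

end PercRepro
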